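import Summits.RiemannHypothesis.RiemannHypothesis.Theorems.Splittings.RobinFiniteDensityTail
import HarnessLib

/-!
# RobinFiniteDensityTwoLayer — gen 12 ZERO-DENSITY LAYER, part 2/4 (D3–D4): the two-layer off-line bound and the consumers with a general off-line bound

Cell rh-split, seat rh-split-robin-finite g12 (card `cards/SPLIT-robin-finite.md` §19).  The tree's c = 1 height law
(`RobinFiniteHeightLaw`, gen 9) pays the unverified zeros `|γ| > T` at the tail-only price `√x·tailH(T)`; parts 1–4 add ONE
explicit zero-density row in print — Fiori–Kadiri–Swidinsky 2023 (J. Math. Anal. Appl. 527, 127426; arXiv:2204.02588) Cor. 2.9,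
Table 2 row `σ ∈ [0.9, 1]`: `N(0.9, T) ≤ 17.4194·T^{4/15}·(log T)^{16/5} + 2.9089·log² T` for `T ≥ H₀ = 3·10¹²` (RH-free; spelled
out as a hypothesis on the tree's count `zetaZeroCountRe 0.9 T`, no named fact introduced) — and show that with it the ZERO SIDE of
the law STOPS BINDING: `RH(T) ∧ {Büthe 2016 Thm 2, Büthe 2018 Thm 2, BKLNW 2021} ∧ FKS-row ⟹ Robin at every CA number with primes
≤ X` for EVERY `X` in Büthe's `θ`-range `4.92·√(X/log X) ≤ T` (`T ≥ 3 000 175 332 800`).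

This part (0 `def`): D3 — the RH-free TWO-LAYER off-line bound `Σ_{|γ|>T} m·x^{β−1/2}/γ² ≤ x^{2/5}·tailH(T) + √x·S(T)`
(`x ≥ 1`, `T ≥ 3·10¹²`; zeros with `β < 0.9` at the tree's tail price `zeroTailBound_tailH`, zeros with `β ≥ 0.9` by part 1);
D4 — the c = 1 consumers re-read with a GENERAL off-line bound `D` on `[2·10²², X]` and Büthe's range condition as a SEPARATE
hypothesis (`mertensProdLt_of_offLine`, `robinCA_below_of_offLine`; bookkeeping verbatim from `mertensProdLt_of_height` /
`robinCA_below_of_height`), and the all-integer bridge `robin_all_of_CA_theta` (`robin_all_of_height`'s body, `θ`-step factored out).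

HONEST LABEL: SPLITTING SEARCH over kernel-typed RH-EQUIVALENCES; a splitting A ∧ B ⟹ RH is CONDITIONAL
bookkeeping unless A and B are both proved; nothing here bears on the truth of RH.
-/

set_option linter.dupNamespace false

noncomputable section

open Real Filter Finset
open scoped Chebyshev ComplexConjugate

namespace Summit.RiemannHypothesis.RiemannHypothesis.Theorems.Splittings.RobinFiniteC1

open Literature.NumberTheory.LFunctions Literature.NumberTheory.DiophantineGeometry
open Literature.NumberTheory.LFunctions.SchoenfeldBound
open Literature.NumberTheory.LFunctions.NicolasJExplicit
open RobinAnalyticSharp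
open Summit.RiemannHypothesis.RiemannHypothesis.Theorems.Splittings.RobinFiniteE3
open Summit.RiemannHypothesis.RiemannHypothesis.Theorems.Splittings.RobinFiniteTail
  (zeroTailBound_tailH tailH_PT_le tailH_nonneg)
open Summit.RiemannHypothesis.RiemannHypothesis.Theorems.Splittings.RobinFiniteE1c (summable_tailTerm)

section Density

/-! ### D3 · RH-free: the TWO-LAYER off-line bound `Σ_{|γ|>T} m·x^{β−1/2}/γ² ≤ x^{2/5}·tailH(T) + √x·S(T)` -/

/-- **The two-layer off-line bound (RH-free).**  For `T ≥ 3·10¹²`, `N(0.9, t) ≤ 1300√t` (`t ≥ 3·10¹²`) and `x ≥ 1`: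
`Σ_{|γ|>T} m·x^{β−1/2}/γ² ≤ x^{2/5}·tailH(T) + √x·(16/7)·2600/(T√T)` — a zero with `β < 0.9` weighs `≤ x^{2/5}·m/γ²`
(all such: the tree's tail theorem `zeroTailBound_tailH`), one with `β ≥ 0.9` weighs `≤ √x·m/γ²` (`densTail_le`). -/
theorem offLine_le_twoLayer {T x : ℝ} (hT : 3 * (10 : ℝ) ^ 12 ≤ T)
    (hN : ∀ t : ℝ, 3 * (10 : ℝ) ^ 12 ≤ t → (zetaZeroCountRe 0.9 t : ℝ) ≤ 1300 * √t) (hx : 1 ≤ x) :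
    ∑' ρ : RHWave0.riemannZetaNontrivialZeros,
        (if T < |(ρ : ℂ).im| then
          (riemannZetaZeroOrder (ρ : ℂ) : ℝ) * x ^ ((ρ : ℂ).re - 1 / 2) / (ρ : ℂ).im ^ 2 else 0) ≤
      x ^ (2 / 5 : ℝ) * ((Real.log (T / (2 * π)) + 1) / (π * T) + (184 + 30 * Real.log T) / T ^ 2) +
        √x * (16 / 7 * (2600 / (T * √T))) := by
  set tail : RHWave0.riemannZetaNontrivialZeros → ℝ := fun ρ =>
    if T < |(ρ : ℂ).im| then (riemannZetaZeroOrder (ρ : ℂ) : ℝ) / (ρ : ℂ).im ^ 2 else 0 with htail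
  set dens : RHWave0.riemannZetaNontrivialZeros → ℝ := fun ρ =>
    if T < |(ρ : ℂ).im| ∧ (0.9 : ℝ) ≤ (ρ : ℂ).re then (riemannZetaZeroOrder (ρ : ℂ) : ℝ) / (ρ : ℂ).im ^ 2 else 0
    with hdens
  have hT7 : (7 : ℝ) ≤ T := le_trans (by norm_num) hT
  have hx0 : 0 ≤ x := by linarith
  have hx25 : 0 ≤ x ^ (2 / 5 : ℝ) := Real.rpow_nonneg hx0 _
  have hsx : 0 ≤ √x := Real.sqrt_nonneg x
  have hStail : Summable tail := summable_tailTerm T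
  have htail_nn : ∀ ρ, 0 ≤ tail ρ := fun ρ => by
    simp only [htail]
    split_ifs
    · exact div_nonneg (zeroOrder_nonneg' ρ) (sq_nonneg _)
    · exact le_rfl
  have hdens_nn : ∀ ρ, 0 ≤ dens ρ := fun ρ => by
    simp only [hdens]
    split_ifs
    · exact div_nonneg (zeroOrder_nonneg' ρ) (sq_nonneg _)
    · exact le_rfl
  have hdens_le : ∀ ρ, dens ρ ≤ tail ρ := fun ρ => by
    simp only [hdens, htail]
    by_cases h1 : T < |(ρ : ℂ).im|
    · by_cases h2 : (0.9 : ℝ) ≤ (ρ : ℂ).re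
      · rw [if_pos ⟨h1, h2⟩, if_pos h1]
      · rw [if_neg (fun h => h2 h.2), if_pos h1]
        exact div_nonneg (zeroOrder_nonneg' ρ) (sq_nonneg _)
    · rw [if_neg (fun h => h1 h.1), if_neg h1]
  have hSdens : Summable dens := hStail.of_nonneg_of_le hdens_nn hdens_le
  have htail_sum : ∑' ρ, tail ρ ≤ (Real.log (T / (2 * π)) + 1) / (π * T) + (184 + 30 * Real.log T) / T ^ 2 :=
    zeroTailBound_tailH hT7
  have hdens_sum : ∑' ρ, dens ρ ≤ 16 / 7 * (2600 / (T * √T)) :=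
    Real.tsum_le_of_sum_le (fun ρ => hdens_nn ρ) fun s => sum_densTerm_le hT hN s
  -- pointwise comparison
  have hpt : ∀ ρ : RHWave0.riemannZetaNontrivialZeros,
      (if T < |(ρ : ℂ).im| then
          (riemannZetaZeroOrder (ρ : ℂ) : ℝ) * x ^ ((ρ : ℂ).re - 1 / 2) / (ρ : ℂ).im ^ 2 else 0) ≤
        x ^ (2 / 5 : ℝ) * tail ρ + √x * dens ρ := by
    intro ρ
    simp only [htail, hdens]
    have hm := zeroOrder_nonneg' ρ
    have hre1 := (ZetaZeros.riemannZetaNontrivialZeros.re_lt_one ρ.2).le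
    by_cases hTρ : T < |(ρ : ℂ).im|
    · rw [if_pos hTρ, if_pos hTρ]
      by_cases hβ : (0.9 : ℝ) ≤ (ρ : ℂ).re
      · rw [if_pos ⟨hTρ, hβ⟩]
        have hpow : x ^ ((ρ : ℂ).re - 1 / 2) ≤ √x := by
          rw [Real.sqrt_eq_rpow]; exact Real.rpow_le_rpow_of_exponent_le hx (by linarith)
        have h1 : (riemannZetaZeroOrder (ρ : ℂ) : ℝ) * x ^ ((ρ : ℂ).re - 1 / 2) / (ρ : ℂ).im ^ 2 ≤
            √x * ((riemannZetaZeroOrder (ρ : ℂ) : ℝ) / (ρ : ℂ).im ^ 2) := by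
          rw [show √x * ((riemannZetaZeroOrder (ρ : ℂ) : ℝ) / (ρ : ℂ).im ^ 2) =
            (riemannZetaZeroOrder (ρ : ℂ) : ℝ) * √x / (ρ : ℂ).im ^ 2 by ring]
          exact div_le_div_of_nonneg_right (mul_le_mul_of_nonneg_left hpow hm) (sq_nonneg _)
        have h2 : 0 ≤ x ^ (2 / 5 : ℝ) * ((riemannZetaZeroOrder (ρ : ℂ) : ℝ) / (ρ : ℂ).im ^ 2) :=
          mul_nonneg hx25 (div_nonneg hm (sq_nonneg _))
        linarith
      · rw [if_neg (fun h => hβ h.2), mul_zero, add_zero]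
        rw [not_le] at hβ
        have hpow : x ^ ((ρ : ℂ).re - 1 / 2) ≤ x ^ (2 / 5 : ℝ) :=
          Real.rpow_le_rpow_of_exponent_le hx (by linarith)
        rw [show x ^ (2 / 5 : ℝ) * ((riemannZetaZeroOrder (ρ : ℂ) : ℝ) / (ρ : ℂ).im ^ 2) =
          (riemannZetaZeroOrder (ρ : ℂ) : ℝ) * x ^ (2 / 5 : ℝ) / (ρ : ℂ).im ^ 2 by ring]
        exact div_le_div_of_nonneg_right (mul_le_mul_of_nonneg_left hpow hm) (sq_nonneg _)
    · rw [if_neg hTρ, if_neg hTρ, if_neg (fun h => hTρ h.1), mul_zero, mul_zero, add_zero]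
  have hnn : ∀ ρ : RHWave0.riemannZetaNontrivialZeros,
      0 ≤ (if T < |(ρ : ℂ).im| then
          (riemannZetaZeroOrder (ρ : ℂ) : ℝ) * x ^ ((ρ : ℂ).re - 1 / 2) / (ρ : ℂ).im ^ 2 else 0) := by
    intro ρ
    split_ifs
    · exact div_nonneg (mul_nonneg (zeroOrder_nonneg' ρ) (Real.rpow_nonneg hx0 _)) (sq_nonneg _)
    · exact le_rfl
  have hS' : Summable (fun ρ => x ^ (2 / 5 : ℝ) * tail ρ + √x * dens ρ) :=
    (hStail.mul_left _).add (hSdens.mul_left _)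
  have hS := hS'.of_nonneg_of_le hnn hpt
  calc ∑' ρ : RHWave0.riemannZetaNontrivialZeros,
        (if T < |(ρ : ℂ).im| then
          (riemannZetaZeroOrder (ρ : ℂ) : ℝ) * x ^ ((ρ : ℂ).re - 1 / 2) / (ρ : ℂ).im ^ 2 else 0)
      ≤ ∑' ρ, (x ^ (2 / 5 : ℝ) * tail ρ + √x * dens ρ) := hS.tsum_le_tsum hpt hS'
    _ = x ^ (2 / 5 : ℝ) * ∑' ρ, tail ρ + √x * ∑' ρ, dens ρ := by
        rw [(hStail.mul_left _).tsum_add (hSdens.mul_left _), tsum_mul_left, tsum_mul_left]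
    _ ≤ x ^ (2 / 5 : ℝ) * ((Real.log (T / (2 * π)) + 1) / (π * T) + (184 + 30 * Real.log T) / T ^ 2) +
          √x * (16 / 7 * (2600 / (T * √T))) :=
        add_le_add (mul_le_mul_of_nonneg_left htail_sum hx25) (mul_le_mul_of_nonneg_left hdens_sum hsx)

/-! ### D4 · consumers: the CA Mertens inequality and Robin at CA numbers from ANY off-line bound `D` on `[2·10²², X]` -/

/-- **The top-window consumer with a GENERAL off-line bound** (cf. the tree's `mertensProdLt_of_height`, whose off-line bound is
`tailH(T)·√X`): RH to height `T ≥ 3 000 175 332 800`, a uniform bound `D ≥ 0` for the weighted off-line sum on `[2·10²², X]` with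
`(1 + 2/log(2·10²²))·D ≤ 0.4857`, and Büthe's range condition `4.92·√(X/log X) ≤ T` — now a SEPARATE hypothesis, no longer implied by
the budget — give the CA Mertens inequality for `4¹¹ ≤ P ≤ X`, `Q ≤ P` (below `2.5·10²²`: gen 8's `mertensProdLt_PT2`; above: the
top window `[2·10²², X]` via `partialNicolasBetween1_holds`, `Eb_top_lt`, `G_large2W`, `c = 2.5745`). -/
theorem mertensProdLt_of_offLine (h16 : Buthe2016_thm2) (hB : Buthe2018_thm2_theta)
    (hK : BroadbentEtAl2021_theta_rel_1e19) {T : ℝ} (hT : 3000175332800 ≤ T) (hRH : RiemannHypothesisUpTo T)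
    {X D : ℝ}
    (hoff : ∀ x : ℝ, 2 * (10 : ℝ) ^ 22 ≤ x → x ≤ X →
      ∑' ρ : RHWave0.riemannZetaNontrivialZeros,
        (if T < |(ρ : ℂ).im| then
          (riemannZetaZeroOrder (ρ : ℂ) : ℝ) * x ^ ((ρ : ℂ).re - 1 / 2) / (ρ : ℂ).im ^ 2 else 0) ≤ D)
    (hD : 0 ≤ D) (hκ : (1 + 2 / Real.log (2 * (10 : ℝ) ^ 22)) * D ≤ 0.4857)
    (hBu : 4.92 * Real.sqrt (X / Real.log X) ≤ T)
    {P Q : ℕ} (hP : 4 ^ 11 ≤ P) (hPX : (P : ℝ) ≤ X) (hQP : Q ≤ P) :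
    (∏ p ∈ Nat.primesLE P, (1 - (p : ℝ)⁻¹))⁻¹ *
        ∏ p ∈ (Nat.primesLE P).filter (fun p => Q < p), (1 - ((p : ℝ) ^ 2)⁻¹) <
      rexp eulerMascheroniConstant * Real.log (θ P + θ Q) := by
  rcases le_or_gt (P : ℝ) (25 * (10 : ℝ) ^ 21) with hlo | hhi
  · exact mertensProdLt_PT2 h16 hB hK (RiemannHypothesisUpTo.mono_of_le hT hRH) hP hlo hQP
  · have h22 : 2 * (10 : ℝ) ^ 22 ≤ P := le_trans (by norm_num) hhi.le
    have hW := thetaWindow_of_height h16 hT hRH hBu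
    have hPr : (4 : ℝ) ^ 11 ≤ P := by exact_mod_cast hP
    have hP599 : (599 : ℝ) ≤ P := le_trans (by norm_num) hPr
    have hP1 : (1 : ℝ) < P := by linarith
    have hbig19 : (2 * 10 ^ 19 : ℝ) ≤ P := le_trans (by norm_num) h22
    have hlow := partialNicolasBetween1_holds hB hK (T := T) (B := X) (X₀ := 2 * (10 : ℝ) ^ 22) (X₁ := X)
      hoff hD (by norm_num) le_rfl hRH hW P hP599 h22 hPX
    have hsL : 0 < √(P : ℝ) * Real.log P := mul_pos (Real.sqrt_pos.2 (by linarith)) (Real.log_pos hP1)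
    have hlt := Eb_top_lt h22 hκ
    have hL₁P : (51.35 : ℝ) ≤ Real.log P := log_2e22_bounds.1.trans (Real.log_le_log (by norm_num) h22)
    have hG := G_large2W hW hbig19 hPX hQP hL₁P (by norm_num) (c := 2.5745) (by norm_num) (by norm_num)
    exact mertens_prod_lt_of hW hP hPX hlow (((lt_div_iff₀ hsL).2 hlt).trans_le hG)

open scoped ArithmeticFunction.sigma in
/-- **Robin at CA numbers from a general off-line bound** (`robinCA_below_of_height`'s bookkeeping with `mertensProdLt_of_offLine`):
RH to height `T ≥ 3 000 175 332 800`, the three RH-free `θ`-facts, an off-line bound `D` on `[2·10²², X]` within the budget, and Büthe's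
range condition for `X` give Robin's inequality at every colossally abundant `N > 5040` all of whose primes are `≤ X`. -/
theorem robinCA_below_of_offLine (h16 : Buthe2016_thm2) (hB : Buthe2018_thm2_theta)
    (hK : BroadbentEtAl2021_theta_rel_1e19) {T : ℝ} (hT : 3000175332800 ≤ T) (hRH : RiemannHypothesisUpTo T)
    {X : ℕ} {D : ℝ}
    (hoff : ∀ x : ℝ, 2 * (10 : ℝ) ^ 22 ≤ x → x ≤ (X : ℝ) →
      ∑' ρ : RHWave0.riemannZetaNontrivialZeros,
        (if T < |(ρ : ℂ).im| then
          (riemannZetaZeroOrder (ρ : ℂ) : ℝ) * x ^ ((ρ : ℂ).re - 1 / 2) / (ρ : ℂ).im ^ 2 else 0) ≤ D)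
    (hD : 0 ≤ D) (hκ : (1 + 2 / Real.log (2 * (10 : ℝ) ^ 22)) * D ≤ 0.4857)
    (hBu : 4.92 * Real.sqrt ((X : ℝ) / Real.log X) ≤ T) :
    robinCA_below (X + 1) := by
  intro N hCA h5040 hprimes
  obtain ⟨ε, P, Q, -, -, hP, hPN, -, hQP, hpf, -, -, hσ, hθ, -⟩ := hCA.exists_structure
  by_cases hsmall : P < 4 ^ 11
  · refine robinCA_below_four_pow_eleven N hCA h5040 fun p hp hpN => lt_of_le_of_lt ?_ hsmall
    have hN0 : N ≠ 0 := by omega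
    have : p ∈ N.primeFactors := Nat.mem_primeFactors.2 ⟨hp, hpN, hN0⟩
    rw [hpf] at this
    exact (Nat.mem_primesLE.1 this).1
  · rw [not_lt] at hsmall
    have hPX : (P : ℝ) ≤ X := by
      have := hprimes P hP hPN
      exact_mod_cast Nat.lt_succ_iff.1 this
    have hlt := mertensProdLt_of_offLine h16 hB hK hT hRH hoff hD hκ hBu hsmall hPX hQP
    have hN0 : N ≠ 0 := by omega
    have hNpos : (0 : ℝ) < N := by exact_mod_cast Nat.pos_of_ne_zero hN0
    have hθpos : 0 < θ P + θ Q := by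
      have h1 : 0 < θ (P : ℝ) := Chebyshev.theta_pos (by exact_mod_cast hP.two_le)
      have h2 : 0 ≤ θ (Q : ℝ) := Chebyshev.theta_nonneg _
      linarith
    have hlog : Real.log (θ P + θ Q) ≤ Real.log (Real.log N) := Real.log_le_log hθpos hθ
    have hlt' : (σ 1 N : ℝ) / N < rexp eulerMascheroniConstant * Real.log (Real.log N) :=
      lt_of_le_of_lt hσ (hlt.trans_le (mul_le_mul_of_nonneg_left hlog (Real.exp_pos _).le))
    unfold robinInequality
    rw [div_lt_iff₀ hNpos] at hlt'
    linarith

/-- **All-integer bridge** (gen 8/9's `robin_all_of_robinCA_below`, the `θ`-step factored out): `robinCA_below (X + 1)` for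
`X ≥ 2³⁰ + 1` together with `θ(X − 1) ≥ 0.99947·(X − 1)` gives Robin's inequality for every `5040 < n` with `log n ≤ 0.99947·(X − 1)`. -/
theorem robin_all_of_CA_theta {X : ℕ} (hX : 2 ^ 30 + 1 ≤ X) (hRB : robinCA_below (X + 1))
    (hW1 : 0.99947 * ((X : ℝ) - 1) ≤ θ ((X : ℝ) - 1)) :
    ∀ n : ℕ, 5040 < n → Real.log n ≤ 0.99947 * ((X : ℝ) - 1) → robinInequality n := by
  classical
  have hX1 : 1 ≤ X := le_trans (by norm_num) hX
  have hXR : ((2 : ℝ) ^ 30 + 1) ≤ (X : ℝ) := by exact_mod_cast hX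
  have h30 : (2 : ℝ) ^ 30 ≤ (X : ℝ) - 1 := by linarith
  set ε : ℝ := Real.log (1 + 1 / (X : ℝ)) / Real.log (X : ℝ) with hε_def
  have hBs1 : (1 : ℝ) < (X : ℝ) := by linarith
  have hε : 0 < ε := by
    refine div_pos (Real.log_pos ?_) (Real.log_pos hBs1)
    have : (0 : ℝ) < 1 / (X : ℝ) := by positivity
    linarith
  obtain ⟨Ns, hNs1, hNs, -⟩ := Nat.exists_greatest_isCAParameter hε
  have hNs0 : Ns ≠ 0 := by omega
  have hthr : ∀ r : ℕ, r.Prime → (r : ℝ) ^ ε ≤ 1 + 1 / r → r < X + 1 := by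
    intro r hr hle
    by_contra hge
    push Not at hge
    have hr' : (X : ℝ) < r := by
      have : ((X + 1 : ℕ) : ℝ) ≤ r := by exact_mod_cast hge
      push_cast at this; linarith
    have := one_add_inv_lt_rpow hBs1 hr'
    rw [← hε_def] at this
    linarith
  have hdiv : ∀ p ∈ Nat.primesLE (X - 1), p ∣ Ns := by
    intro p hp
    obtain ⟨hple, hpp⟩ := Nat.mem_primesLE.1 hp
    refine dvd_of_rpow_lt hNs hNs0 hpp (rpow_lt_one_add_inv hBs1 (by exact_mod_cast hpp.one_lt) ?_)
    have h1 : p < X := by omega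
    exact_mod_cast h1
  have hprod : (∏ p ∈ Nat.primesLE (X - 1), p) ∣ Ns :=
    Finset.prod_primes_dvd Ns (fun p hp => (Nat.mem_primesLE.1 hp).2.prime) hdiv
  have hlogNs : 0.99947 * ((X : ℝ) - 1) ≤ Real.log Ns := by
    have hle : (∏ p ∈ Nat.primesLE (X - 1), p) ≤ Ns := Nat.le_of_dvd (by omega) hprod
    have hpos : ∀ p ∈ Nat.primesLE (X - 1), ((p : ℕ) : ℝ) ≠ 0 := fun p hp => by
      exact_mod_cast (Nat.mem_primesLE.1 hp).2.ne_zero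
    have h1 : Real.log ((∏ p ∈ Nat.primesLE (X - 1), p : ℕ) : ℝ) = θ (((X - 1 : ℕ)) : ℝ) := by
      rw [Chebyshev.theta_eq_sum_primesLE_log, Nat.cast_prod, Real.log_prod hpos]
    have hprodpos : (0 : ℝ) < ((∏ p ∈ Nat.primesLE (X - 1), p : ℕ) : ℝ) := by
      rw [Nat.cast_prod]; exact Finset.prod_pos fun p hp => by exact_mod_cast (Nat.mem_primesLE.1 hp).2.pos
    have h2 : Real.log ((∏ p ∈ Nat.primesLE (X - 1), p : ℕ) : ℝ) ≤ Real.log Ns :=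
      Real.log_le_log hprodpos (by exact_mod_cast hle)
    have hcast : (((X - 1 : ℕ)) : ℝ) = (X : ℝ) - 1 := Nat.cast_pred (by omega)
    rw [h1, hcast] at h2
    exact hW1.trans h2
  have hNs5040 : 5040 < Ns := by
    by_contra hle
    push Not at hle
    have h1 : (Ns : ℝ) ≤ 5040 := by exact_mod_cast hle
    have h2 : Real.log Ns ≤ Real.log 5040 := Real.log_le_log (by exact_mod_cast hNs1) h1
    have h3 : Real.log 5040 ≤ 5040 - 1 := Real.log_le_sub_one_of_pos (by norm_num)
    have h4 : (2 : ℝ) ^ 30 = 1073741824 := by norm_num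
    rw [h4] at h30
    linarith
  intro n hn hlog
  refine robin_all_of_robinCA_below hRB hε hthr hNs hNs5040 n hn ?_
  by_contra hgt
  push Not at hgt
  have h3 : Real.log Ns < Real.log n :=
    Real.log_lt_log (by exact_mod_cast hNs1) (by exact_mod_cast hgt)
  linarith

end Density

end Summit.RiemannHypothesis.RiemannHypothesis.Theorems.Splittings.RobinFiniteC1

end
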